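import Summits.ValiantsHypothesis.ValiantsHypothesis.Theorems.GrenetZeonDualUnipotentThreeHalvesSlowCoreDefs
import Summits.ValiantsHypothesis.ValiantsHypothesis.Theorems.DualUnipotentThreeHalves.Negative.HeavyTopInstThreeFive

/-!
# `GrenetZeon.DualUnipotentThreeHalves` (stmt-ValiantsHypothesis-24318) — successor line `slow_core`, NEGATIVE lane:
# THE FORMAT `(3, 5)` IS FALSE IN POWER CURRENCY TOO — `¬ Slow 3 5 NFive`, unconditionally (no coordinate reduction)

Experiment cell «val-heavytop-census» (D-0160), engine seat val-htc-eng-1 g2 (kernel-only lane, director-valiant g17 R315 (4)).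
CENSUS-GRID v0.6b §0 (G) records that the flag-currency ✗ cells of the instance table do NOT transfer automatically to the
successor head currency (R2ᵖ `HeavyTopSlowLaw`, conclusion `Slow n m N`, ✓ `…SlowCoreDefs`; R306/R307/R310): `¬FlagCheap ⇏ ¬Slow`
(the ratio knapsack `E(n)` is slow by cancellation), and books the re-decision of `(3,5)` / `(4,7)` in `Slow` currency «modulo the
coordinate-`K` reduction H» as successor work.  THIS FILE re-decides `(3,5)` in the kernel WITHOUT any reduction: the `(3,5)` witness
pencil ✓ `NFive` (tops `𝔫₅ ∩ {a₁₅ = 0}`, ✓ p635270 `not_heavyTopInst_three_five`) is not slow.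

Proof.  `Slow 3 5 NFive` asks for `K ≤ ℂ^{3×3}` and `k` with `3(k+1) < dim K ≤ 9` — so `k ≤ 1` — such that every entry of
`N(x + s v)² = (Q(x) + s·Q(v))²`, `v ∈ K`, has `s`-degree `≤ k` (`Q = topFive`).  Along a line the pencil is
`Q(x) + s·Q(v)` (`NFive_map_lineSubst`), its square has entries `Q(x)²ᵢⱼ + s·(Q(x)Q(v) + Q(v)Q(x))ᵢⱼ + s²·Q(v)²ᵢⱼ` (`sq_apply`).
* `k = 1` (`dim K ≥ 7`): at `x = 0` the `s²`-coefficient is `Q(v)²`, so `Q(v)² = 0` on `K`; then verbatim as in ✓ p635270: the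
  entries `v₁₂v₂₃` and `v₃₄v₄₅` of `Q(v)²` kill one coordinate of each pair on `K` (✓ `forall_apply_eq_zero_or`), `K` is the
  `7`-dimensional joint kernel of two coordinates (✓ `finrank_ker_inf_ker_le`), contains ✓ `vZero = e₁₃ + e₃₅`, and
  `Q(vZero)² = E₁₅ ≠ 0` (✓ `topFive_vZero_sq_ne_zero`).
* `k = 0` (`dim K ≥ 4`): pick `0 ≠ v ∈ K` and a coordinate `v_c ≠ 0`; for a suitable coordinate vector `x` ONE entry of the
  `s`-linear coefficient `Q(x)Q(v) + Q(v)Q(x)` equals `v_c` (`exists_linear_coeff_ne_zero`), so that entry has `s`-degree `≥ 1`.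

* ★ `not_slow_three_five : ¬ Slow 3 5 NFive`, `not_slowR_three_five : ¬ SlowR 3 5 NFive`;
* ★ `not_heavyTopSlowInst_three_five` — the BODY of R2ᵖ `HeavyTopSlowLaw` at format `(3,5)` fails (the heavy-top hypothesis is
  vacuous at `n = 3`: `dim K ≤ 9 ≤ 16·5·⌊√3⌋ + 48`).

HONEST LABEL.  Exactly as for ✓ `not_heavyTopInst_three_five`: this does NOT refute R2ᵖ `HeavyTopSlowLaw` (`∃ C₀ n₀, ∀ n ≥ n₀ …` —
take `n₀ ≥ 4` or `C₀ ≥ 2` and `(3,5)` is discarded); it is the same TINY-`n` ARTEFACT, now certified in the successor currency: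
`C₀ = 1 ∧ n₀ ≤ 3` is not an admissible parameter choice for R2ᵖ either, and the `(3,5)` cell of the census grid reads ✗ in BOTH
currencies.  `--supports stmt-ValiantsHypothesis-24318` (Negative lane); 24318, S3, R2ᵖ, IRR, RED, rung 8062 and `VP ≠ VNP` are
OPEN / NOT proved.  No definitions, no named facts. [CENSUS-GRID v0.6b §0 (G); ✓ `…Negative.HeavyTopInstThreeFive`; ✓ `…SlowCoreDefs`]
-/

set_option linter.dupNamespace false
set_option autoImplicit false

noncomputable section

namespace Summit.ValiantsHypothesis.ValiantsHypothesis.Theorems.DualUnipotentThreeHalvesNegative.SlowThreeFive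

open MvPolynomial Matrix
open scoped BigOperators
open Summit.ValiantsHypothesis.ValiantsHypothesis.Cruxes.TwoDimCoefficients.DimTwoCases (AffMat IsAffine)
open Summit.ValiantsHypothesis.ValiantsHypothesis.Theorems.GrenetZeon.RadicalSplit
  (lineSubst RadOrth NFive topFive vZero isAffine_NFive NFive_pow forall_apply_eq_zero_or finrank_ker_inf_ker_le
    topFive_vZero_sq_ne_zero)
open Summit.ValiantsHypothesis.ValiantsHypothesis.Theorems.GrenetZeon.SlowCore (Slow SlowR slow_of_slowR)

/-! ## §1 The pencil along a line and its square -/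

/-- Along the line `x + s·v` the pencil `NFive` is `Q(x) + s·Q(v)` (`Q = topFive`, `s = X 0`). -/
theorem NFive_map_lineSubst (x v : Fin 3 × Fin 3 → ℂ) :
    NFive.map (lineSubst x v) =
      (topFive x).map C + (X 0 : MvPolynomial (Fin 1) ℂ) • (topFive v).map C := by
  ext i j
  fin_cases i <;> fin_cases j <;> simp [NFive, topFive, lineSubst, Matrix.map_apply, mul_comm]

/-- An entry of the square along a line: `Q(x)²ᵢⱼ + s·(Q(x)Q(v) + Q(v)Q(x))ᵢⱼ + s²·Q(v)²ᵢⱼ`. -/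
theorem sq_apply (x v : Fin 3 × Fin 3 → ℂ) (i j : Fin 5) :
    ((NFive.map (lineSubst x v)) ^ 2) i j =
      C ((topFive x * topFive x) i j) + C ((topFive x * topFive v + topFive v * topFive x) i j) * X 0 ^ 1
        + C ((topFive v * topFive v) i j) * X 0 ^ 2 := by
  rw [NFive_map_lineSubst, sq, Matrix.mul_apply]
  simp only [Matrix.add_apply, Matrix.smul_apply, Matrix.map_apply, smul_eq_mul, Matrix.mul_apply, Fin.sum_univ_five,
    map_add, map_mul]
  ring

/-- The `s²`-coefficient of an entry of the square is the entry of `Q(v)²`. -/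
theorem coeff_two_sq (x v : Fin 3 × Fin 3 → ℂ) (i j : Fin 5) :
    coeff (Finsupp.single 0 2) (((NFive.map (lineSubst x v)) ^ 2) i j) = (topFive v * topFive v) i j := by
  rw [sq_apply]
  have h21 : (Finsupp.single (0 : Fin 1) 1 : Fin 1 →₀ ℕ) ≠ Finsupp.single 0 2 := by
    rw [Ne, Finsupp.single_eq_single_iff]; omega
  have h20 : (0 : Fin 1 →₀ ℕ) ≠ Finsupp.single 0 2 := by
    rw [Ne, eq_comm, Finsupp.single_eq_zero]; omega
  simp only [coeff_add, coeff_C_mul, coeff_C, coeff_X_pow, h21, h20, if_true, if_false, mul_one, mul_zero, add_zero,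
    zero_add]

/-- The `s`-coefficient of an entry of the square is the entry of `Q(x)Q(v) + Q(v)Q(x)`. -/
theorem coeff_one_sq (x v : Fin 3 × Fin 3 → ℂ) (i j : Fin 5) :
    coeff (Finsupp.single 0 1) (((NFive.map (lineSubst x v)) ^ 2) i j) =
      (topFive x * topFive v + topFive v * topFive x) i j := by
  rw [sq_apply]
  have h12 : (Finsupp.single (0 : Fin 1) 2 : Fin 1 →₀ ℕ) ≠ Finsupp.single 0 1 := by
    rw [Ne, Finsupp.single_eq_single_iff]; omega
  have h10 : (0 : Fin 1 →₀ ℕ) ≠ Finsupp.single 0 1 := by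
    rw [Ne, eq_comm, Finsupp.single_eq_zero]; omega
  simp only [coeff_add, coeff_C_mul, coeff_C, coeff_X_pow, h12, h10, if_true, if_false, mul_one, mul_zero, add_zero,
    zero_add]

/-- A nonzero `s²`-coefficient forces `s`-degree `≥ 2`. -/
theorem two_le_totalDegree {x v : Fin 3 × Fin 3 → ℂ} {i j : Fin 5} (h : (topFive v * topFive v) i j ≠ 0) :
    2 ≤ (((NFive.map (lineSubst x v)) ^ 2) i j).totalDegree := by
  have hs : (Finsupp.single (0 : Fin 1) 2 : Fin 1 →₀ ℕ) ∈ (((NFive.map (lineSubst x v)) ^ 2) i j).support := by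
    rw [mem_support_iff, coeff_two_sq]; exact h
  have := le_totalDegree hs
  simpa using this

/-- A nonzero `s`-coefficient forces `s`-degree `≥ 1`. -/
theorem one_le_totalDegree {x v : Fin 3 × Fin 3 → ℂ} {i j : Fin 5}
    (h : (topFive x * topFive v + topFive v * topFive x) i j ≠ 0) :
    1 ≤ (((NFive.map (lineSubst x v)) ^ 2) i j).totalDegree := by
  have hs : (Finsupp.single (0 : Fin 1) 1 : Fin 1 →₀ ℕ) ∈ (((NFive.map (lineSubst x v)) ^ 2) i j).support := by
    rw [mem_support_iff, coeff_one_sq]; exact h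
  have := le_totalDegree hs
  simpa using this

/-! ## §2 The `s`-linear coefficient isolates every coordinate -/

/-- For `v ≠ 0` some coordinate direction `x` and some entry make the `s`-linear coefficient `Q(x)Q(v) + Q(v)Q(x)` non-zero:
the entry `(a−1, b)` for `x = e_{(a−1,a)}` sees `v_{ab}` (`a ≥ 2`), the entry `(1, d)` for `x = e_{(b,d)}` sees `v_{1b}`. -/
theorem exists_linear_coeff_ne_zero (v : Fin 3 × Fin 3 → ℂ) (hv : v ≠ 0) :
    ∃ (x : Fin 3 × Fin 3 → ℂ) (i j : Fin 5), (topFive x * topFive v + topFive v * topFive x) i j ≠ 0 := by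
  have key : ∃ c, v c ≠ 0 := by
    by_contra h
    simp only [not_exists, not_not] at h
    exact hv (funext h)
  obtain ⟨⟨a, b⟩, hc⟩ := key
  -- `x = e_c'` as a function
  fin_cases a <;> fin_cases b
  · -- v (0,0) = q₁₂ ≠ 0: x = e_{(1,0)} (q₂₃), entry (0,2)
    refine ⟨fun c => if c = ((1 : Fin 3), (0 : Fin 3)) then 1 else 0, 0, 2, ?_⟩
    simpa [topFive, Matrix.mul_apply, Matrix.add_apply, Fin.sum_univ_five] using hc
  · -- v (0,1) = q₁₃: x = e_{(2,0)} (q₃₄), entry (0,3)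
    refine ⟨fun c => if c = ((2 : Fin 3), (0 : Fin 3)) then 1 else 0, 0, 3, ?_⟩
    simpa [topFive, Matrix.mul_apply, Matrix.add_apply, Fin.sum_univ_five] using hc
  · -- v (0,2) = q₁₄: x = e_{(2,2)} (q₄₅), entry (0,4)
    refine ⟨fun c => if c = ((2 : Fin 3), (2 : Fin 3)) then 1 else 0, 0, 4, ?_⟩
    simpa [topFive, Matrix.mul_apply, Matrix.add_apply, Fin.sum_univ_five] using hc
  · -- v (1,0) = q₂₃: x = e_{(0,0)} (q₁₂), entry (0,2)
    refine ⟨fun c => if c = ((0 : Fin 3), (0 : Fin 3)) then 1 else 0, 0, 2, ?_⟩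
    simpa [topFive, Matrix.mul_apply, Matrix.add_apply, Fin.sum_univ_five] using hc
  · -- v (1,1) = q₂₄: x = e_{(0,0)} (q₁₂), entry (0,3)
    refine ⟨fun c => if c = ((0 : Fin 3), (0 : Fin 3)) then 1 else 0, 0, 3, ?_⟩
    simpa [topFive, Matrix.mul_apply, Matrix.add_apply, Fin.sum_univ_five] using hc
  · -- v (1,2) = q₂₅: x = e_{(0,0)} (q₁₂), entry (0,4)
    refine ⟨fun c => if c = ((0 : Fin 3), (0 : Fin 3)) then 1 else 0, 0, 4, ?_⟩
    simpa [topFive, Matrix.mul_apply, Matrix.add_apply, Fin.sum_univ_five] using hc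
  · -- v (2,0) = q₃₄: x = e_{(1,0)} (q₂₃), entry (1,3)
    refine ⟨fun c => if c = ((1 : Fin 3), (0 : Fin 3)) then 1 else 0, 1, 3, ?_⟩
    simpa [topFive, Matrix.mul_apply, Matrix.add_apply, Fin.sum_univ_five] using hc
  · -- v (2,1) = q₃₅: x = e_{(1,0)} (q₂₃), entry (1,4)
    refine ⟨fun c => if c = ((1 : Fin 3), (0 : Fin 3)) then 1 else 0, 1, 4, ?_⟩
    simpa [topFive, Matrix.mul_apply, Matrix.add_apply, Fin.sum_univ_five] using hc
  · -- v (2,2) = q₄₅: x = e_{(2,0)} (q₃₄), entry (2,4)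
    refine ⟨fun c => if c = ((2 : Fin 3), (0 : Fin 3)) then 1 else 0, 2, 4, ?_⟩
    simpa [topFive, Matrix.mul_apply, Matrix.add_apply, Fin.sum_univ_five] using hc

/-! ## §3 The verdict at format `(3, 5)` in power currency -/

/-- ★ **`NFive` is not slow at `n = 3`**: `¬ Slow 3 5 NFive` (unconditional; no coordinate reduction). [this file] -/
theorem not_slow_three_five : ¬ Slow 3 5 NFive := by
  classical
  rintro ⟨K, k, hK', hdim⟩
  have hK : ∀ x v : Fin 3 × Fin 3 → ℂ, v ∈ K → ∀ i j : Fin 5,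
      ((((NFive.map (lineSubst x v)) ^ 2) i j).totalDegree ≤ k) := fun x v hv i j => by
    simpa using hK' x v hv i j
  have hV9 : Module.finrank ℂ (Fin 3 × Fin 3 → ℂ) = 9 := by simp [Module.finrank_fintype_fun_eq_card]
  have hKle : Module.finrank ℂ K ≤ 9 := by
    have h1 := Submodule.finrank_le K
    omega
  have hk1 : k ≤ 1 := by
    by_contra hk
    have : 3 * 3 ≤ (k + 1) * 3 := Nat.mul_le_mul_right 3 (by omega)
    omega
  rcases Nat.le_one_iff_eq_zero_or_eq_one.1 hk1 with rfl | rfl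
  · -- budget 0: `dim K ≥ 4`, so `K` has a non-zero vector, and some entry has positive `s`-degree
    have hKne : K ≠ ⊥ := by
      intro h; rw [h, finrank_bot] at hdim; omega
    obtain ⟨v, hvK, hv0⟩ := Submodule.exists_mem_ne_zero_of_ne_bot hKne
    obtain ⟨x, i, j, hne⟩ := exists_linear_coeff_ne_zero v hv0
    have h1 := one_le_totalDegree (x := x) hne
    have h0 := hK x v hvK i j
    omega
  · -- budget 1: square-zero tops on `K` with `dim K ≥ 7`
    have hsq : ∀ v ∈ K, topFive v * topFive v = 0 := by
      intro v hv
      ext i j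
      by_contra hne
      have h2 := two_le_totalDegree (x := 0) hne
      have h1 := hK 0 v hv i j
      omega
    have e02 : ∀ v ∈ K, v (0,0) * v (1,0) = 0 := fun v hv => by
      simpa [topFive, Matrix.mul_apply, Fin.sum_univ_five] using congr_fun (congr_fun (hsq v hv) 0) 2
    have e24 : ∀ v ∈ K, v (2,0) * v (2,2) = 0 := fun v hv => by
      simpa [topFive, Matrix.mul_apply, Fin.sum_univ_five] using congr_fun (congr_fun (hsq v hv) 2) 4
    have key : ∀ a b : Fin 3 × Fin 3, a ≠ b → vZero a = 0 → vZero b = 0 →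
        (∀ v ∈ K, v a = 0) → (∀ v ∈ K, v b = 0) → False := by
      intro a b hab ha0 hb0 hKa hKb
      have hKL : K ≤ LinearMap.ker (LinearMap.proj a : (Fin 3 × Fin 3 → ℂ) →ₗ[ℂ] ℂ) ⊓
          LinearMap.ker (LinearMap.proj b : (Fin 3 × Fin 3 → ℂ) →ₗ[ℂ] ℂ) := fun v hv => by
        rw [Submodule.mem_inf, LinearMap.mem_ker, LinearMap.mem_ker, LinearMap.proj_apply, LinearMap.proj_apply]
        exact ⟨hKa v hv, hKb v hv⟩
      have hKeq := Submodule.eq_of_le_of_finrank_le hKL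
        (by have := finrank_ker_inf_ker_le a b hab; omega)
      have hv0 : vZero ∈ K := by
        rw [hKeq, Submodule.mem_inf, LinearMap.mem_ker, LinearMap.mem_ker, LinearMap.proj_apply, LinearMap.proj_apply]
        exact ⟨ha0, hb0⟩
      exact topFive_vZero_sq_ne_zero (hsq vZero hv0)
    rcases forall_apply_eq_zero_or K (0,0) (1,0) e02 with hA | hA <;>
      rcases forall_apply_eq_zero_or K (2,0) (2,2) e24 with hB | hB
    · exact key (0,0) (2,0) (by decide) (by simp [vZero]) (by simp [vZero]) hA hB
    · exact key (0,0) (2,2) (by decide) (by simp [vZero]) (by simp [vZero]) hA hB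
    · exact key (1,0) (2,0) (by decide) (by simp [vZero]) (by simp [vZero]) hA hB
    · exact key (1,0) (2,2) (by decide) (by simp [vZero]) (by simp [vZero]) hA hB

/-- `NFive` is not window-slow either (`SlowR ⇒ Slow`). [this file] -/
theorem not_slowR_three_five : ¬ SlowR 3 5 NFive := fun h => not_slow_three_five (slow_of_slowR h)

/-- ★ **The format `(3, 5)` of R2ᵖ is FALSE in power currency**: the BODY of `HeavyTopSlowLaw` at `n = 3`, `m = 5` fails on
`NFive` (admissible for `C₀ = 1`: `25 < 27`; the heavy-top hypothesis is vacuous at `n = 3`).  NOT a refutation of R2ᵖ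
(`n₀ ≥ 4` or `C₀ ≥ 2` discards it) — the tiny-`n` data point `C₀ = 1 ∧ n₀ ≤ 3` is inadmissible in BOTH currencies. [this file] -/
theorem not_heavyTopSlowInst_three_five :
    ¬ (∀ N : AffMat 3 5, IsAffine N → N ^ 5 = 0 →
        (∀ K : Submodule ℂ (Fin 3 × Fin 3 → ℂ), RadOrth 3 5 N K →
          Module.finrank ℂ K ≤ 16 * 5 * Nat.sqrt 3 + 16 * 3) →
        Slow 3 5 N) := by
  intro h
  have hV9 : Module.finrank ℂ (Fin 3 × Fin 3 → ℂ) = 9 := by simp [Module.finrank_fintype_fun_eq_card]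
  refine not_slow_three_five (h NFive isAffine_NFive NFive_pow fun K _ => ?_)
  have h1 := Submodule.finrank_le K
  omega

end Summit.ValiantsHypothesis.ValiantsHypothesis.Theorems.DualUnipotentThreeHalvesNegative.SlowThreeFive

end
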